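import Mathlib
import Literature.NumberTheory.Transcendental.KZCalculusProofs
import Literature.NumberTheory.Transcendental.KZLogCalculusProofs
import Literature.NumberTheory.Transcendental.KZHomotopyMoves
import Literature.NumberTheory.Transcendental.KZProductIdeal
import Literature.NumberTheory.Transcendental.KZSemialgebraicComplex
import Literature.NumberTheory.Transcendental.KZIdealTetrahedron
import Literature.NumberTheory.Transcendental.KZIntervalPeriodProofs
import Literature.NumberTheory.Transcendental.KZDominatedFamilyRelations
import Summits.KontsevichZagierPeriods.KontsevichZagierPeriods.Theorems.HyperbolicBlochOffTetraSectorKernelStubLogRectSweep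
import Summits.KontsevichZagierPeriods.KontsevichZagierPeriods.Theorems.HyperbolicBlochOffTetraSectorKernelStubMoebiusCovLift
import Summits.KontsevichZagierPeriods.KontsevichZagierPeriods.Theorems.HyperbolicBlochOffTetraSectorKernelAbelFiveTermStrip

/-!
# `OffTetraSectorKernel`, line `odd-hyperbolic-ladder` (v9): Abel's five-term equation — the logarithmic side

INTEGRATION BY PARTS INSIDE THE CALCULUS. For real algebraic `0 < x, y < 1` the logarithmic side of
Abel's equation, the log rectangle `M = [(1,P₁)×(1,Q₁), 1/(uw)]` (`P₁ = (1−xy)/(1−x)`, `Q₁ = (1−xy)/(1−y)`,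
value `log P₁ log Q₁`), is move-equivalent to the difference of two unfolded-logarithm bands over the
homotopy interval `0 < t < y`: `[M] ≡ [CX] − [DS]`, `CX = [{1 ≤ w ≤ P(t)}, (Q′/Q)(t)/w]`,
`DS = [{1 ≤ w ≤ Q(t)}, (−P′/P)(t)/w]`, `P(t) = (1−xt)/(1−x)`, `Q(t) = (1−xt)/(1−t)` — the formula
`log P₁ log Q₁ = ∫₀^y ((Q′/Q) log P + (P′/P) log Q) dt` as moves: the region `R` swept by the curve
`t ↦ (P(t), Q(t))` is `M ⊔ S` (`stub_logRectSweep`, rule (1a)); `R` re-based along `Q` is `CX` and the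
curvilinear triangle `S` re-based along `P` is `DS` (`stub_moebiusCovLift`, rule (2)), after a
coordinate swap and the opening/closing of fibres (null sets).

References: M. Kontsevich, D. Zagier, *Periods* (2001), §1.2.
-/

noncomputable section

open Set MeasureTheory
open Literature.NumberTheory.Transcendental Literature.ModelTheory.ExponentialFields

namespace Summit.KontsevichZagierPeriods.HyperbolicBloch.OffTetraSectorKernel

/-! ### The curvilinear triangle `S` is the band `DS` -/

/-- The open curvilinear triangle `{P₁ < u, u(w − x) < w, 1 < w < Q₁}` is `ℚ`-semialgebraic.
[cite: KontsevichZagier2001, §1.1] -/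
theorem abel_isSemialgebraic_openS {x y : ℝ} (hx : IsAlgebraic ℚ x) (hy : IsAlgebraic ℚ y) :
    IsSemialgebraic ℚ {w : Fin 2 → ℝ | (1 - x * y) / (1 - x) < w 0 ∧ w 0 * (w 1 - x) < w 1 ∧
      1 < w 1 ∧ w 1 < (1 - x * y) / (1 - y)} := by
  have hU : IsSemialgebraic ℚ (univ : Set (Fin 2 → ℝ)) := isSemialgebraic_univ
  have hco : ∀ i : Fin 2, IsSemialgebraicFunOn ℚ (univ : Set (Fin 2 → ℝ)) (fun p => p i) :=
    fun i => isSemialgebraicFunOn_apply hU i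
  have hc : ∀ {c : ℝ}, IsAlgebraic ℚ c → IsSemialgebraicFunOn ℚ (univ : Set (Fin 2 → ℝ)) (fun _ => c) :=
    fun h => isSemialgebraicFunOn_const_of_isAlgebraic hU h
  have hP : IsAlgebraic ℚ ((1 - x * y) / (1 - x)) :=
    (isAlgebraic_one.sub (hx.mul hy)).mul (isAlgebraic_one.sub hx).inv
  have hQ : IsAlgebraic ℚ ((1 - x * y) / (1 - y)) :=
    (isAlgebraic_one.sub (hx.mul hy)).mul (isAlgebraic_one.sub hy).inv
  have hprod : IsSemialgebraicFunOn ℚ (univ : Set (Fin 2 → ℝ)) (fun w => w 0 * (w 1 - x)) :=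
    (IsSemialgebraicFunOn.mul_holds (hco 0) (IsSemialgebraicFunOn.sub_holds (hco 1) (hc hx))).congr
      fun w _ => by simp
  have S1 := isSemialgebraic_setOf_lt_of_isSemialgebraicFunOn (hc hP) (hco 0)
  have S2 := isSemialgebraic_setOf_lt_of_isSemialgebraicFunOn hprod (hco 1)
  have S3 := isSemialgebraic_setOf_lt_of_isSemialgebraicFunOn (hc isAlgebraic_one) (hco 1)
  have S4 := isSemialgebraic_setOf_lt_of_isSemialgebraicFunOn (hco 1) (hc hQ)
  convert S1.inter (S2.inter (S3.inter S4)) using 1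
  ext w
  simp only [mem_inter_iff, mem_setOf_eq]

/-- **`[S] ≡ [DS]`**: the curvilinear triangle `S = {P₁ ≤ u, u(w−x) < w, 1 < w < Q₁}` (integrand `1/(uw)`),
off its null edge `u = P₁`, is the open band `{P₁ < u < 1/(1−x), 1 < w < xu/(u−1)}`; closing the fibres
and changing the base by `u = P(t) = (1−xt)/(1−x)` (`stub_moebiusCovLift`, `(a,b,c,d) = (−x,1,0,1−x)`,
`xP/(P−1) = Q`, `−P′/P = x/(1−xt)`) gives `DS = [{0<t<y, 1 ≤ w ≤ Q(t)}, x/((1−xt)w)]`.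
[cite: KontsevichZagier2001, §1.2 rule (2)] -/
theorem abel_S_sub_DS {x y : ℝ} (hx : IsAlgebraic ℚ x) (hy : IsAlgebraic ℚ y) (hx0 : 0 < x)
    (hx1 : x < 1) (hy0 : 0 < y) (hy1 : y < 1) (S DS : KZ.IntegralRep 2)
    (hS : S.domain = {w | (1 - x * y) / (1 - x) ≤ w 0 ∧ w 0 * (w 1 - x) < w 1 ∧ 1 < w 1 ∧
      w 1 < (1 - x * y) / (1 - y)})
    (hSi : EqOn S.integrand (fun w => 1 / (w 0 * w 1)) S.domain)
    (hDS : DS.domain = {z | (0 < z 0 ∧ z 0 < y) ∧ 1 ≤ z 1 ∧ z 1 ≤ (1 - x * z 0) / (1 - z 0)})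
    (hDSi : EqOn DS.integrand (fun z => x / ((1 - x * z 0) * z 1)) DS.domain) :
    KZ.of S - KZ.of DS ∈ KZ.relations := by
  set P₁ : ℝ := (1 - x * y) / (1 - x) with hP₁
  set Q₁ : ℝ := (1 - x * y) / (1 - y) with hQ₁
  have hP1 : 1 < P₁ := by rw [hP₁, lt_div_iff₀ (by linarith)]; nlinarith
  have hPlt : P₁ < 1 / (1 - x) := abel_P₁_lt hx0 hx1 hy0
  have hPalg : IsAlgebraic ℚ P₁ := (isAlgebraic_one.sub (hx.mul hy)).mul (isAlgebraic_one.sub hx).inv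
  have hIalg : IsAlgebraic ℚ (1 / (1 - x)) := by
    simpa using (isAlgebraic_one.sub hx).inv
  have hxP : x * P₁ / (P₁ - 1) = Q₁ := abel_xP₁_div hx0 hx1 hy1
  -- off the null edge `u = P₁`
  set T : Set (Fin 2 → ℝ) := {w | P₁ < w 0 ∧ w 0 * (w 1 - x) < w 1 ∧ 1 < w 1 ∧ w 1 < Q₁} with hT
  have hTsa : IsSemialgebraic ℚ T := abel_isSemialgebraic_openS hx hy
  have hTsub : T ⊆ S.domain := by
    rw [hS]; rintro w ⟨h1, h2, h3, h4⟩; exact ⟨h1.le, h2, h3, h4⟩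
  have s7 : KZ.of S - KZ.of (S.restrict T hTsa hTsub) ∈ KZ.relations := by
    refine S.of_sub_of_restrict_mem_relations hTsa hTsub
      (measure_mono_null (fun w hw => ?_) (by
        rw [volume_pi]
        exact Measure.pi_hyperplane (fun _ : Fin 2 => (volume : Measure ℝ)) (0 : Fin 2) P₁ :
        volume {w : Fin 2 → ℝ | w 0 = P₁} = 0))
    rw [hS] at hw
    obtain ⟨⟨h1, h2, h3, h4⟩, hw⟩ := hw
    simp only [hT, mem_setOf_eq, not_and] at hw
    by_contra hne
    exact hw (lt_of_le_of_ne h1 (Ne.symm hne)) h2 h3 h4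
  -- the closed band over `(P₁, 1/(1−x))` with fibre `[1, xu/(u−1)]`
  have hσ : IsSemialgebraic ℚ {p : Fin 1 → ℝ | P₁ < p 0 ∧ p 0 < 1 / (1 - x)} :=
    isSemialgebraic_logIvl hPalg hIalg
  have hG : IsSemialgebraicFunOn ℚ {p : Fin 1 → ℝ | P₁ < p 0 ∧ p 0 < 1 / (1 - x)} (fun p => 1 / p 0) :=
    (abel_isSemialgebraicFunOn_moebius hσ 0 isAlgebraic_zero isAlgebraic_one isAlgebraic_one
      isAlgebraic_zero (fun p hp => by have := hp.1; simp; linarith)).congr fun p _ => by simp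
  have hV : IsSemialgebraicFunOn ℚ {p : Fin 1 → ℝ | P₁ < p 0 ∧ p 0 < 1 / (1 - x)}
      (fun p => x * p 0 / (p 0 - 1)) :=
    (abel_isSemialgebraicFunOn_moebius hσ 0 hx isAlgebraic_zero isAlgebraic_one
      isAlgebraic_one.neg (fun p hp => by have := hp.1; linarith)).congr fun p _ => by simp; ring
  obtain ⟨B, hBd, hBi⟩ := abel_exists_band hPalg hIalg (fun u => 1 / u) (fun u => x * u / (u - 1))
    (1 / (P₁ - 1)) hG hV (fun t ht1 ht2 => by
      have h1 : 0 < t - 1 := by linarith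
      rw [le_div_iff₀ h1]
      rw [lt_div_iff₀ (by linarith)] at ht2
      nlinarith) (fun t ht1 ht2 => by
      have h1 : 0 < t - 1 := by linarith
      rw [lt_div_iff₀ (by linarith)] at ht2
      have h2 : x * t / (t - 1) - 1 = (1 - t * (1 - x)) / (t - 1) := by field_simp; ring
      have hnum : 0 ≤ 1 - t * (1 - x) := by nlinarith
      rw [h2, abs_of_pos (one_div_pos.2 (by linarith))]
      calc 1 / t * ((1 - t * (1 - x)) / (t - 1)) ≤ 1 * (1 / (P₁ - 1)) := by
            apply mul_le_mul _ _ (div_nonneg hnum h1.le) zero_le_one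
            · rw [div_le_one (by linarith)]; linarith
            · exact div_le_div₀ zero_le_one (by nlinarith) (by linarith) (by linarith)
        _ = 1 / (P₁ - 1) := one_mul _)
  have ha : IsSemialgebraicFunOn ℚ {p : Fin 1 → ℝ | P₁ < p 0 ∧ p 0 < 1 / (1 - x)} (fun _ => (1 : ℝ)) := by
    simpa using isSemialgebraicFunOn_ratCast hσ 1
  obtain ⟨So, hSod, hSoi, s6⟩ := KZ.of_sub_of_restrict_openBand_mem_relations ha hV B (by
    rw [hBd]; ext z
    simp only [mem_setOf_eq, KZlog.band, Fin.init, Fin.castSucc_zero, Fin.last]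
    rfl)
  have s8 : KZ.of (S.restrict T hTsa hTsub) - KZ.of So ∈ KZ.relations := by
    refine KZ.of_sub_of_mem_relations_of_eqOn ?_ fun z hz => ?_
    · rw [KZ.IntegralRep.domain_restrict, hSod, hT]
      ext z
      simp only [mem_setOf_eq, Fin.init, Fin.castSucc_zero, Fin.last]
      change ((P₁ < z 0 ∧ z 0 < 1 / (1 - x)) ∧ 1 < z 1 ∧ z 1 < x * z 0 / (z 0 - 1)) ↔
        (P₁ < z 0 ∧ z 0 * (z 1 - x) < z 1 ∧ 1 < z 1 ∧ z 1 < Q₁)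
      constructor
      · rintro ⟨⟨h1, h2⟩, h3, h4⟩
        have h5 : 0 < z 0 - 1 := by linarith
        rw [lt_div_iff₀ h5] at h4
        refine ⟨h1, by nlinarith, h3, ?_⟩
        have h6 : x * z 0 / (z 0 - 1) ≤ Q₁ := by
          rw [← hxP, div_le_div_iff₀ h5 (by linarith)]
          nlinarith
        exact lt_of_lt_of_le ((lt_div_iff₀ h5).2 h4) h6
      · rintro ⟨h1, h2, h3, h4⟩
        have h5 : 0 < z 0 - 1 := by linarith
        refine ⟨⟨h1, ?_⟩, h3, by rw [lt_div_iff₀ h5]; nlinarith⟩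
        rw [lt_div_iff₀ (by linarith)]
        nlinarith
    · have hzT : z ∈ T := by simpa [KZ.IntegralRep.domain_restrict] using hz
      rw [KZ.IntegralRep.integrand_restrict, hSi (hTsub hzT), hSoi, hBi]
      simp only [div_div]
  -- the base change `u = P(t)`
  have hmy : (-x * y + 1) / (0 * y + (1 - x)) = P₁ := by rw [hP₁]; congr 1 <;> ring
  have hm0 : (-x * 0 + 1) / (0 * 0 + (1 - x)) = 1 / (1 - x) := by congr 1 <;> ring
  have s9 : KZ.of DS - KZ.of B ∈ KZ.relations := by
    refine stub_moebiusCovLift (-x) 1 0 (1 - x) 0 y hx.neg isAlgebraic_one isAlgebraic_zero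
      (isAlgebraic_one.sub hx) isAlgebraic_zero hy hy0 (by nlinarith) (fun t _ => by nlinarith)
      (fun p => x * ((-x * p 0 + 1) / (0 * p 0 + (1 - x))) / ((-x * p 0 + 1) / (0 * p 0 + (1 - x)) - 1))
      (fun q => x * q 0 / (q 0 - 1)) (fun p _ _ => rfl) DS B ?_ ?_ ?_
    · rw [hDS]
      ext z
      simp only [mem_setOf_eq]
      constructor
      · rintro ⟨⟨h0, h1⟩, h2, h3⟩
        exact ⟨⟨h0, h1⟩, h2, by rwa [abel_vQ_eq hx0 hx1 (h1.trans hy1)]⟩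
      · rintro ⟨⟨h0, h1⟩, h2, h3⟩
        exact ⟨⟨h0, h1⟩, h2, by rwa [abel_vQ_eq hx0 hx1 (h1.trans hy1)] at h3⟩
    · rw [hBd]
      ext z
      have hmin : min ((-x * 0 + 1) / (0 * 0 + (1 - x))) ((-x * y + 1) / (0 * y + (1 - x))) = P₁ := by
        rw [hmy, hm0]; exact min_eq_right hPlt.le
      have hmax : max ((-x * 0 + 1) / (0 * 0 + (1 - x))) ((-x * y + 1) / (0 * y + (1 - x))) =
          1 / (1 - x) := by
        rw [hmy, hm0]; exact max_eq_left hPlt.le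
      simp only [mem_setOf_eq, hmin, hmax]
    · intro z hz
      have hz' := hz
      rw [hDS] at hz'
      obtain ⟨⟨hz0, hzy⟩, hz1, -⟩ := hz'
      rw [hDSi hz, hBi]
      have habs : |(-x) * (1 - x) - 1 * 0| = x * (1 - x) := by
        rw [show (-x) * (1 - x) - 1 * 0 = -(x * (1 - x)) by ring, abs_neg, abs_of_pos (by nlinarith)]
      simp only [Matrix.cons_val_zero, Matrix.cons_val_one, habs]
      have hz1' : z 1 ≠ 0 := by positivity
      have h4 : 1 - x * z 0 ≠ 0 := by nlinarith
      have h5 : 1 - x ≠ 0 := by linarith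
      rw [one_div_div, show 0 * z 0 + (1 - x) = 1 - x by ring, show -x * z 0 + 1 = 1 - x * z 0 by ring]
      field_simp
  have : KZ.of S - KZ.of DS = (KZ.of S - KZ.of (S.restrict T hTsa hTsub)) +
      (KZ.of (S.restrict T hTsa hTsub) - KZ.of So) - (KZ.of B - KZ.of So) - (KZ.of DS - KZ.of B) := by
    abel
  rw [this]
  exact KZ.relations.sub_mem (KZ.relations.sub_mem (KZ.relations.add_mem s7 s8) s6) s9

/-! ### The logarithmic side -/

/-- The swept region `R = {1 < u, u(w−x) < w, 1 < w < Q₁}` is `ℚ`-semialgebraic.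
[cite: KontsevichZagier2001, §1.1] -/
theorem abel_isSemialgebraic_R {x y : ℝ} (hx : IsAlgebraic ℚ x) (hy : IsAlgebraic ℚ y) :
    IsSemialgebraic ℚ {w : Fin 2 → ℝ | 1 < w 0 ∧ w 0 * (w 1 - x) < w 1 ∧ 1 < w 1 ∧
      w 1 < (1 - x * y) / (1 - y)} := by
  have hU : IsSemialgebraic ℚ (univ : Set (Fin 2 → ℝ)) := isSemialgebraic_univ
  have hco : ∀ i : Fin 2, IsSemialgebraicFunOn ℚ (univ : Set (Fin 2 → ℝ)) (fun p => p i) :=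
    fun i => isSemialgebraicFunOn_apply hU i
  have hc : ∀ {c : ℝ}, IsAlgebraic ℚ c → IsSemialgebraicFunOn ℚ (univ : Set (Fin 2 → ℝ)) (fun _ => c) :=
    fun h => isSemialgebraicFunOn_const_of_isAlgebraic hU h
  have hQ : IsAlgebraic ℚ ((1 - x * y) / (1 - y)) :=
    (isAlgebraic_one.sub (hx.mul hy)).mul (isAlgebraic_one.sub hy).inv
  have hprod : IsSemialgebraicFunOn ℚ (univ : Set (Fin 2 → ℝ)) (fun w => w 0 * (w 1 - x)) :=
    (IsSemialgebraicFunOn.mul_holds (hco 0) (IsSemialgebraicFunOn.sub_holds (hco 1) (hc hx))).congr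
      fun w _ => by simp
  have S1 := isSemialgebraic_setOf_lt_of_isSemialgebraicFunOn (hc isAlgebraic_one) (hco 0)
  have S2 := isSemialgebraic_setOf_lt_of_isSemialgebraicFunOn hprod (hco 1)
  have S3 := isSemialgebraic_setOf_lt_of_isSemialgebraicFunOn (hc isAlgebraic_one) (hco 1)
  have S4 := isSemialgebraic_setOf_lt_of_isSemialgebraicFunOn (hco 1) (hc hQ)
  convert S1.inter (S2.inter (S3.inter S4)) using 1
  ext w
  simp only [mem_inter_iff, mem_setOf_eq]

/-- The closed curvilinear triangle `S = {P₁ ≤ u, u(w−x) < w, 1 < w < Q₁}` is `ℚ`-semialgebraic.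
[cite: KontsevichZagier2001, §1.1] -/
theorem abel_isSemialgebraic_S {x y : ℝ} (hx : IsAlgebraic ℚ x) (hy : IsAlgebraic ℚ y) :
    IsSemialgebraic ℚ {w : Fin 2 → ℝ | (1 - x * y) / (1 - x) ≤ w 0 ∧ w 0 * (w 1 - x) < w 1 ∧ 1 < w 1 ∧
      w 1 < (1 - x * y) / (1 - y)} := by
  have hU : IsSemialgebraic ℚ (univ : Set (Fin 2 → ℝ)) := isSemialgebraic_univ
  have hco : ∀ i : Fin 2, IsSemialgebraicFunOn ℚ (univ : Set (Fin 2 → ℝ)) (fun p => p i) :=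
    fun i => isSemialgebraicFunOn_apply hU i
  have hc : ∀ {c : ℝ}, IsAlgebraic ℚ c → IsSemialgebraicFunOn ℚ (univ : Set (Fin 2 → ℝ)) (fun _ => c) :=
    fun h => isSemialgebraicFunOn_const_of_isAlgebraic hU h
  have hP : IsAlgebraic ℚ ((1 - x * y) / (1 - x)) :=
    (isAlgebraic_one.sub (hx.mul hy)).mul (isAlgebraic_one.sub hx).inv
  have hQ : IsAlgebraic ℚ ((1 - x * y) / (1 - y)) :=
    (isAlgebraic_one.sub (hx.mul hy)).mul (isAlgebraic_one.sub hy).inv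
  have hf : IsSemialgebraicFunOn ℚ (univ : Set (Fin 2 → ℝ)) (fun w => w 0 - (1 - x * y) / (1 - x)) :=
    (IsSemialgebraicFunOn.sub_holds (hco 0) (hc hP)).congr fun w _ => by simp
  have hprod : IsSemialgebraicFunOn ℚ (univ : Set (Fin 2 → ℝ)) (fun w => w 0 * (w 1 - x)) :=
    (IsSemialgebraicFunOn.mul_holds (hco 0) (IsSemialgebraicFunOn.sub_holds (hco 1) (hc hx))).congr
      fun w _ => by simp
  have S1 : IsSemialgebraic ℚ {w : Fin 2 → ℝ | (1 - x * y) / (1 - x) ≤ w 0} := by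
    convert hf.isSemialgebraic_sep_nonneg using 1
    ext w; simp [sub_nonneg]
  have S2 := isSemialgebraic_setOf_lt_of_isSemialgebraicFunOn hprod (hco 1)
  have S3 := isSemialgebraic_setOf_lt_of_isSemialgebraicFunOn (hc isAlgebraic_one) (hco 1)
  have S4 := isSemialgebraic_setOf_lt_of_isSemialgebraicFunOn (hco 1) (hc hQ)
  convert S1.inter (S2.inter (S3.inter S4)) using 1
  ext w
  simp only [mem_inter_iff, mem_setOf_eq]

/-- **THE LOGARITHMIC SIDE: `[M] ≡ [CX] − [DS]`** (integration by parts inside the calculus). For any log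
rectangle `M` on `(1,P₁)×(1,Q₁)` and any bands `CX`, `DS` as above, `[M] − [CX] + [DS]` is a relation:
the swept region `R` and the curvilinear triangle `S` exist as representations (bounded integrand
`1/(uw) ≤ 1` on bounded sets), `[R] = [M] + [S]` (`stub_logRectSweep`), `[R] ≡ [CX]` and `[S] ≡ [DS]`.
[cite: KontsevichZagier2001, §1.2] -/
theorem abel_logSide :
    ∀ (x y : ℝ), IsAlgebraic ℚ x → IsAlgebraic ℚ y → 0 < x → x < 1 → 0 < y → y < 1 →
    ∀ (M CX DS : KZ.IntegralRep 2),
      M.domain = {w | 1 < w 0 ∧ w 0 < (1 - x * y) / (1 - x) ∧ 1 < w 1 ∧ w 1 < (1 - x * y) / (1 - y)} →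
      Set.EqOn M.integrand (fun w => 1 / (w 0 * w 1)) M.domain →
      CX.domain = {z | (0 < z 0 ∧ z 0 < y) ∧ 1 ≤ z 1 ∧ z 1 ≤ (1 - x * z 0) / (1 - x)} →
      Set.EqOn CX.integrand (fun z => (1 - x) / ((1 - x * z 0) * (1 - z 0) * z 1)) CX.domain →
      DS.domain = {z | (0 < z 0 ∧ z 0 < y) ∧ 1 ≤ z 1 ∧ z 1 ≤ (1 - x * z 0) / (1 - z 0)} →
      Set.EqOn DS.integrand (fun z => x / ((1 - x * z 0) * z 1)) DS.domain →
      KZ.of M - KZ.of CX + KZ.of DS ∈ KZ.relations := by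
  intro x y hx hy hx0 hx1 hy0 hy1 M CX DS hM hMi hCX hCXi hDS hDSi
  have hP1 : 1 < (1 - x * y) / (1 - x) := by rw [lt_div_iff₀ (by linarith)]; nlinarith
  have hQ1 : 1 < (1 - x * y) / (1 - y) := abel_one_lt_Q₁ hx1 hy0 hy1
  -- a common bound for the coordinates of `R ⊇ M, S`
  have hbound : ∀ w : Fin 2 → ℝ, 1 ≤ w 0 → w 0 * (w 1 - x) < w 1 → 1 < w 1 → w 1 < (1 - x * y) / (1 - y) →
      ∀ i, |w i| ≤ 1 / (1 - x) + (1 - x * y) / (1 - y) := by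
    intro w h1 h2 h3 h4 i
    have hI : 0 < 1 / (1 - x) := one_div_pos.2 (by linarith)
    have h0 : w 0 < 1 / (1 - x) := by
      rw [lt_div_iff₀ (by linarith)]; nlinarith
    have hQ0 : 0 < (1 - x * y) / (1 - y) := by linarith
    fin_cases i
    · show |w 0| ≤ _
      rw [abs_of_pos (by linarith)]; linarith
    · show |w 1| ≤ _
      rw [abs_of_pos (by linarith)]; linarith
  have hfsa : ∀ {σ : Set (Fin 2 → ℝ)}, IsSemialgebraic ℚ σ → (∀ w ∈ σ, 1 ≤ w 0 ∧ 1 < w 1) →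
      IsSemialgebraicFunOn ℚ σ (fun w : Fin 2 → ℝ => 1 / (w 0 * w 1)) := by
    intro σ hσ hpos
    have h1 : IsSemialgebraicFunOn ℚ σ (fun _ : Fin 2 → ℝ => (1 : ℝ)) := by
      simpa using isSemialgebraicFunOn_ratCast hσ 1
    exact h1.div (IsSemialgebraicFunOn.mul_holds (isSemialgebraicFunOn_apply hσ 0)
      (isSemialgebraicFunOn_apply hσ 1)) fun w hw => by
        have := hpos w hw; exact mul_ne_zero (by linarith [this.1]) (by linarith [this.2])
  have hfb : ∀ w : Fin 2 → ℝ, 1 ≤ w 0 → 1 < w 1 → |1 / (w 0 * w 1)| ≤ 1 := by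
    intro w h1 h2
    rw [abs_of_pos (one_div_pos.2 (by nlinarith)), div_le_one (by nlinarith)]
    nlinarith
  obtain ⟨R, hRd, hRi⟩ := abel_exists_rep_of_bounded (abel_isSemialgebraic_R hx hy)
    (abel_isBounded_of_abs_le _ fun w hw => hbound w hw.1.le hw.2.1 hw.2.2.1 hw.2.2.2)
    (hfsa (abel_isSemialgebraic_R hx hy) fun w hw => ⟨hw.1.le, hw.2.2.1⟩)
    (fun w hw => hfb w hw.1.le hw.2.2.1)
  obtain ⟨S, hSd, hSi⟩ := abel_exists_rep_of_bounded (abel_isSemialgebraic_S hx hy)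
    (abel_isBounded_of_abs_le _ fun w hw => hbound w (hP1.le.trans hw.1) hw.2.1 hw.2.2.1 hw.2.2.2)
    (hfsa (abel_isSemialgebraic_S hx hy) fun w hw => ⟨hP1.le.trans hw.1, hw.2.2.1⟩)
    (fun w hw => hfb w (hP1.le.trans hw.1) hw.2.2.1)
  have s1 : KZ.of R - KZ.of M - KZ.of S ∈ KZ.relations :=
    stub_logRectSweep x y hx hy hx0 hx1 hy0 hy1 M R S hM hMi hRd (fun w _ => by rw [hRi]) hSd
      (fun w _ => by rw [hSi])
  have s2 : KZ.of R - KZ.of CX ∈ KZ.relations :=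
    abel_swept_sub_CX x y hx hy hx0 hx1 hy0 hy1 R CX hRd (fun w _ => by rw [hRi]) hCX hCXi
  have s3 : KZ.of S - KZ.of DS ∈ KZ.relations :=
    abel_S_sub_DS hx hy hx0 hx1 hy0 hy1 S DS hSd (fun w _ => by rw [hSi]) hDS hDSi
  have : KZ.of M - KZ.of CX + KZ.of DS = -(KZ.of R - KZ.of M - KZ.of S) + (KZ.of R - KZ.of CX) -
      (KZ.of S - KZ.of DS) := by abel
  rw [this]
  exact KZ.relations.sub_mem (KZ.relations.add_mem (KZ.relations.neg_mem s1) s2) s3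

end Summit.KontsevichZagierPeriods.HyperbolicBloch.OffTetraSectorKernel

end
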